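import Summits.BirchSwinnertonDyer.BirchSwinnertonDyer.Theses.PrintCf2
import Summits.BirchSwinnertonDyer.BirchSwinnertonDyer.Theorems.PrintCf2RamifiedOffTYZSMinusLeaf
import HarnessLib

/-!
# Route `PrintCf2`, aside stmt-BirchSwinnertonDyer-20705 `RamifiedSMinusOfFacts` — CLOSED: Monsky's family `𝒮⁻` inside the
# ramified bundle, BY NAME (cell `bsd-print-cf2`, p1)

HONEST FRAMING (cell `bsd-print-cf2`, run/shared/lean/pub/bsd-print-cf2/; route `PrintCf2`, leaf CornerF @ `p = 2` =
`WAllCornerFTwo`, OPEN AS A CLASS): a CLOSING file — it imports the route file and proves ONE item whose statement carries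
its published inputs as an antecedent (facts-relative «OfFacts» typing; nothing asserted, no named fact introduced). The
aside (planner g3, rev 6, on this seat's TURNKEY) is `𝔅_ram → Summit.BirchSwinnertonDyer.WAllCornerFTwoRamifiedSMinus`:
granted the eleven facts of the ramified bundle, every globally minimal CM curve of analytic rank one with `2` ramified in
`K` that is a `ℚ`-model of `E_{2pq}` with `p ≡ 5 (8)`, `q ≡ 3 (4)`, `(p/q) = −1` (Monsky's `𝒮⁻`) satisfies BSD(E,2). The
mathematics is in `Theorems/PrintCf2RamifiedOffTYZSMinusLeaf.lean` (p546023: `PrintCf2.stub_offTYZ_sMinusLeaf`, from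
conjunct 11 `tian2014_system_sMinus_genus` ALONE via cell `bsd-monsky`'s `P2.congruentSilentEvenFiveBSDTwo_of_genusSystem_descent`
and ty2's fact-free transport) and the leaf file `Rank1Residual/WAll/TargetCMTwoRamifiedSMinus.lean` (p544597); here only
the one-line term. Booking currency (referee g2 16:10:36Z): LITERAL-by-name(hTSYS). Beyond print: YES (Monsky 1990
Math. Z. 204 p. 67 Remark (3) conjecture; no printed proof). Strategy sentence (p1): «Tian–Yuan–Zhang induction BY NAME …
typed as class theorems on explicit infinite families». [cite: Monsky1990MockHeegner, p. 67 Remark (3)]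
[cite: Tian2014, Thm. 2.8 (J132)] [cite: Miller2011LMS, §1 and Def. 1.1]
-/

noncomputable section

open scoped Classical

open Summit.BirchSwinnertonDyer
open Summit.BirchSwinnertonDyer.BirchSwinnertonDyer.Theses.PrintCf2

set_option autoImplicit false
-- `Summit.BirchSwinnertonDyer.BirchSwinnertonDyer.Theorems` is the layout's namespace (Sub = Summit name).
set_option linter.dupNamespace false

namespace Summit.BirchSwinnertonDyer.BirchSwinnertonDyer.Theorems

/-- **Item 20705 holds**: `𝔅_ram ⟹` the `𝒮⁻` leaf, by `PrintCf2.stub_offTYZ_sMinusLeaf` (conjunct 11 of the bundle).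
[cite: Monsky1990MockHeegner, p. 67 Remark (3)] [cite: Tian2014, Thm. 2.8 (J132)] -/
theorem ramifiedSMinusOfFacts_proof : RamifiedSMinusOfFacts :=
  fun hB ↦ Summit.BirchSwinnertonDyer.PrintCf2.stub_offTYZ_sMinusLeaf hB

end Summit.BirchSwinnertonDyer.BirchSwinnertonDyer.Theorems

end
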